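import Summits.QuantumFields.YangMills.Theses.SqueezedSkewness
import Summits.QuantumFields.YangMills.Theorems.SqueezedSkewnessTorusKLMixedParseval
import HarnessLib

/-!
# Route `SqueezedSkewness`, crux `TorusKL` (stmt-QuantumFields-23204), birth skeleton LINE α «torus-direct Källén–Lehmann»:
# the REGISTERED STUB `stub_mixedParseval` BY NAME AND SIGNATURE

This file reproduces VERBATIM (in its own namespace, to avoid clashing with the in-tree skeleton module; the one unused `let amp` binder of
`stub_torusMixtureData` is renamed `_amp` for the unused-variable linter — the proposition is unchanged) the name-keyed statements
`__Registered.stub_torusMixtureData`, `__Registered.stub_mixedParseval` and the composition `TorusKL_of` of the registered birth skeleton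
`Cruxes/NT/Lines/torus_kl_birth.lean` (planner ym-idea-6 g10, @8fbc357c975b) and proves the registered STUB
`theorem stub_mixedParseval : __Registered.stub_mixedParseval` from the landed content
`Theorems.SqueezedSkewnessTorusKLMixedParseval.mixedParseval` (per-reference-state joint diagonalisation without contraction hypothesis,
mixture over the thermal weights, variance atom, enumeration of the countable index set by `ℕ`).  With it the crux is
`TorusKL ⇐ stub_torusMixtureData` only (`torusKL_of_torusMixtureData`).

Width seat `ym-line-sfw-p2-w2` g22 (cell ym-idea-1; free hands).  HONEST FRAMING: `stub_torusMixtureData` (L: the transfer-operator / site-RP datum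
of the finite-period torus as a thermal mixture on `ℓ²(ℕ)`) is NOT proved here; no crux, route, NT statement or mass gap is proved.
References: M. Reed, B. Simon, *Methods of Modern Mathematical Physics I* (1980), Thm. VI.16 [cite: ReedSimonI1980, Thm. VI.16];
I. Montvay, G. Münster, *Quantum Fields on a Lattice* (1994) §3.2 [cite: MontvayMunster1994, (3.145)].
-/

set_option autoImplicit false

namespace Summit.QuantumFields.YangMills.Theorems.SqueezedSkewnessTorusKLStub

open Summit.QuantumFields.YangMills.Theses.SqueezedSkewness

/-! ## Name-keyed statements of the two registered stubs (verbatim from the birth skeleton) -/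
namespace __Registered

/-- Statement of `stub_torusMixtureData` (L): torus OS / transfer-operator data on ℓ²(ℕ) as a thermal mixture, with the
finite-period covariance identity (variance atom split off). -/
abbrev stub_torusMixtureData : Prop :=
  ∀ (G : Type) [Group G] [TopologicalSpace G] [IsTopologicalGroup G] [CompactSpace G], letI : MeasurableSpace G := borel G; haveI : BorelSpace G := ⟨rfl⟩; ∀ (r : Literature.MathematicalPhysics.QuantumFieldTheory.LatticeRep G), let St : ℕ → ℕ → Type := fun S T => Literature.MathematicalPhysics.QuantumFieldTheory.FinTorusSite S S S T; let Cfg : ℕ → ℕ → Type := fun S T => Literature.MathematicalPhysics.QuantumFieldTheory.FinTorusSite S S S T × Fin 4 → G; let cc : (n : ℕ) → Fin n → ℤ := fun n i => if 2 * i.val < n then (i.val : ℤ) else (i.val : ℤ) - n; let posE : (S T : ℕ) → St S T → EuclideanSpace ℝ (Fin 4) := fun S T x => Literature.MathematicalPhysics.QuantumLattice.siteToE (d := 4) ![cc T x.2.2.2, cc S x.1, cc S x.2.1, cc S x.2.2.1]; let P : (S T : ℕ) → St S T → Fin 4 → Fin 4 → Cfg S T → ℝ := fun _ _ x i j U =>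 (r.ρ (Literature.MathematicalPhysics.QuantumFieldTheory.finTorusPlaquette U x i j)).trace.re; let A : (S T : ℕ) → St S T → Cfg S T → ℝ := fun S T x U => ∑ q : {q : Fin 4 × Fin 4 // q.1 < q.2}, P S T x q.1.1 q.1.2 U; let w : ℝ → (S T : ℕ) → Cfg S T → ℝ := fun β S T U => Real.exp (-β * ∑ x : St S T, ∑ q : {q : Fin 4 × Fin 4 // q.1 < q.2}, ((r.N : ℝ) - P S T x q.1.1 q.1.2 U)); let E : ℝ → (S T : ℕ) → (Cfg S T → ℝ) → ℝ := fun β S T F => (∫ U : Literature.MathematicalPhysics.QuantumFieldTheory.FinTorusSite S S S T × Fin 4 → G, F U * w β S T U ∂MeasureTheory.Measure.pi (fun _ => Literature.MathematicalPhysics.QuantumFieldTheory.haarProbability G)) / Literature.MathematicalPhysics.QuantumFieldTheory.wilsonFinTorusPartition r.ρ β S S S T; let Cov : ℝ → (S T : ℕ) → (Cfg S T → ℝ) → (Cfg S T → ℝ) → ℝ := fun β S T F F' => E β S T (fun U => F U * F' U) - E β S T F * E β S T F'; let refl : (S T : ℕ) → Cfg S T → Cfg S T := fun _ T U e => if e.2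 = Fin.last 3 then (U ((e.1.1, e.1.2.1, e.1.2.2.1, Fin.rev e.1.2.2.2), Fin.last 3))⁻¹ else U ((e.1.1, e.1.2.1, e.1.2.2.1, ⟨(T - e.1.2.2.2.val) % T, Nat.mod_lt _ e.1.2.2.2.pos⟩), e.2); let B : (S T : ℕ) → ℝ → SchwartzMap (EuclideanSpace ℝ (Fin 4)) ℝ → Cfg S T → ℝ := fun S T s f U => ∑ x : St S T, f (s • posE S T x) * A S T x U; let Qrp : ℝ → (S T : ℕ) → ℝ → SchwartzMap (EuclideanSpace ℝ (Fin 4)) ℝ → ℝ := fun β S T s f => Cov β S T (fun U => B S T s f (refl S T U)) (B S T s f); let _amp : ℝ → SchwartzMap (EuclideanSpace ℝ (Fin 4)) ℝ → ℝ → (Fin 3 → ℝ) → ℂ := fun s f μ p => ∑' x : Fin 4 → ℤ, (((f (s • Literature.MathematicalPhysics.QuantumLattice.siteToE (d := 4) x) * μ ^ (Int.toNat (x 0 - 1))) : ℝ) : ℂ) * Complex.exp (Complex.I * ((s * ∑ k : Fin 3, p k * (x k.succ : ℝ) : ℝ) : ℂ)); ∀ (β : ℝ) (L T : ℕ) (s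 : ℝ), 0 ≤ β → 1 ≤ L → 1 ≤ T → 0 < s → ∃ (p : ℕ → ℝ) (W₀ : ℝ) (P : ℕ → (lp (fun _ : ℕ => ℂ) 2 →L[ℂ] lp (fun _ : ℕ => ℂ) 2)) (U : ℕ → (Fin 3 → ℤ) → (lp (fun _ : ℕ => ℂ) 2 →L[ℂ] lp (fun _ : ℕ => ℂ) 2)) (ψ : ℕ → lp (fun _ : ℕ => ℂ) 2), (∀ i, 0 ≤ p i) ∧ 0 ≤ W₀ ∧ (∀ i : ℕ, IsSelfAdjoint (P i) ∧ IsCompactOperator (P i) ∧ (∀ v : lp (fun _ : ℕ => ℂ) 2, 0 ≤ RCLike.re (inner ℂ (P i v) v)) ∧ U i 0 = 1 ∧ (∀ x y : Fin 3 → ℤ, U i (x + y) = U i x * U i y) ∧ (∀ x y : Fin 3 → ℤ, (∀ k, ((x k : ℤ) : ZMod (2 * L + 1)) = ((y k : ℤ) : ZMod (2 * L + 1))) → U i x = U i y) ∧ (∀ (x : Fin 3 → ℤ) (v : lp (fun _ : ℕ => ℂ) 2), ‖U i x v‖ = ‖v‖) ∧ (∀ x : Fin 3 → ℤ, P i * U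 i x = U i x * P i)) ∧ ∀ (H : ℝ) (f : SchwartzMap (EuclideanSpace ℝ (Fin 4)) ℝ), 2 * H + 3 * s ≤ s * T → tsupport (f : EuclideanSpace ℝ (Fin 4) → ℝ) ⊆ {y : EuclideanSpace ℝ (Fin 4) | 0 < y 0 ∧ y 0 ≤ H} → tsupport (f : EuclideanSpace ℝ (Fin 4) → ℝ) ⊆ {y : EuclideanSpace ℝ (Fin 4) | ∀ i : Fin 3, |y i.succ| < s * (L + 1 / 2)} → HasSum (fun i : ℕ => p i * ‖(∑' x : Fin 4 → ℤ, ((f (s • Literature.MathematicalPhysics.QuantumLattice.siteToE (d := 4) x) : ℝ) : ℂ) • ((P i ^ (Int.toNat (x 0 - 1))) ((U i (fun k : Fin 3 => x k.succ)) (ψ i))))‖ ^ 2) (Qrp β (2 * L + 1) T s f - W₀ * (∑' x : Fin 4 → ℤ, f (s • Literature.MathematicalPhysics.QuantumLattice.siteToE (d := 4) x)) ^ 2)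

/-- Statement of `stub_mixedParseval` (M): per-reference-state joint diagonalisation + Parseval, mixed with weights `p i`,
plus the variance atom ⇒ the Källén–Lehmann `HasSum` with `W ≥ 0`, `μ ≥ 0` and reciprocal-lattice momenta. -/
abbrev stub_mixedParseval : Prop :=
  ∀ (L T : ℕ) (s : ℝ), 1 ≤ L → 1 ≤ T → 0 < s → ∀ (Q : SchwartzMap (EuclideanSpace ℝ (Fin 4)) ℝ → ℝ) (p : ℕ → ℝ) (W₀ : ℝ) (P : ℕ → (lp (fun _ : ℕ => ℂ) 2 →L[ℂ] lp (fun _ : ℕ => ℂ) 2)) (U : ℕ → (Fin 3 → ℤ) → (lp (fun _ : ℕ => ℂ) 2 →L[ℂ] lp (fun _ : ℕ => ℂ) 2)) (ψ : ℕ → lp (fun _ : ℕ => ℂ) 2), (∀ i, 0 ≤ p i) → 0 ≤ W₀ → (∀ i : ℕ, IsSelfAdjoint (P i) ∧ IsCompactOperator (P i) ∧ (∀ v : lp (fun _ : ℕ => ℂ) 2, 0 ≤ RCLike.re (inner ℂ (P i v) v)) ∧ U i 0 = 1 ∧ (∀ x y : Fin 3 → ℤ, U i (x + y) = U i x * U i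 y) ∧ (∀ x y : Fin 3 → ℤ, (∀ k, ((x k : ℤ) : ZMod (2 * L + 1)) = ((y k : ℤ) : ZMod (2 * L + 1))) → U i x = U i y) ∧ (∀ (x : Fin 3 → ℤ) (v : lp (fun _ : ℕ => ℂ) 2), ‖U i x v‖ = ‖v‖) ∧ (∀ x : Fin 3 → ℤ, P i * U i x = U i x * P i)) → (∀ (H : ℝ) (f : SchwartzMap (EuclideanSpace ℝ (Fin 4)) ℝ), 2 * H + 3 * s ≤ s * T → tsupport (f : EuclideanSpace ℝ (Fin 4) → ℝ) ⊆ {y : EuclideanSpace ℝ (Fin 4) | 0 < y 0 ∧ y 0 ≤ H} → tsupport (f : EuclideanSpace ℝ (Fin 4) → ℝ) ⊆ {y : EuclideanSpace ℝ (Fin 4) | ∀ i : Fin 3, |y i.succ| < s * (L + 1 / 2)} → HasSum (fun i : ℕ => p i * ‖(∑' x : Fin 4 → ℤ, ((f (s • Literature.MathematicalPhysics.QuantumLattice.siteToE (d := 4) x) : ℝ) : ℂ) • ((P i ^ (Int.toNat (x 0 - 1))) ((U i (fun k : Fin 3 => x k.succ)) (ψ i))))‖ ^ 2) (Q f - W₀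 * (∑' x : Fin 4 → ℤ, f (s • Literature.MathematicalPhysics.QuantumLattice.siteToE (d := 4) x)) ^ 2)) → ∃ (W μ : ℕ → ℝ) (q : ℕ → Fin 3 → ℤ), (∀ n, 0 ≤ W n) ∧ (∀ n, 0 ≤ μ n) ∧ ∀ (H : ℝ) (f : SchwartzMap (EuclideanSpace ℝ (Fin 4)) ℝ), 2 * H + 3 * s ≤ s * T → tsupport (f : EuclideanSpace ℝ (Fin 4) → ℝ) ⊆ {y : EuclideanSpace ℝ (Fin 4) | 0 < y 0 ∧ y 0 ≤ H} → tsupport (f : EuclideanSpace ℝ (Fin 4) → ℝ) ⊆ {y : EuclideanSpace ℝ (Fin 4) | ∀ i : Fin 3, |y i.succ| < s * (L + 1 / 2)} → HasSum (fun n : ℕ => W n * ‖(∑' x : Fin 4 → ℤ, (((f (s • Literature.MathematicalPhysics.QuantumLattice.siteToE (d := 4) x) * μ n ^ (Int.toNat (x 0 - 1))) : ℝ) : ℂ) * Complex.exp (Complex.I * ((s * ∑ k : Fin 3, (2 * Real.pi * (q n k : ℝ) / (s * (2 * L + 1))) * (x k.succ : ℝ) : ℝ) : ℂ)))‖ ^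 2) (Q f)

end __Registered

/-! ## The registered stub `stub_mixedParseval`, by name and signature -/

/-- **STUB `stub_mixedParseval` HOLDS** (pure operator theory + bookkeeping: `SqueezedSkewnessTorusKLMixedParseval.mixedParseval`).
[cite: ReedSimonI1980, Thm. VI.16] -/
theorem stub_mixedParseval : __Registered.stub_mixedParseval :=
  Summit.QuantumFields.YangMills.Theorems.SqueezedSkewnessTorusKLMixedParseval.mixedParseval

/-! ## Composition (verbatim from the skeleton): the crux BY NAME from the two stub statements -/

/-- **TorusKL_of** — conclusion = the route decl `Summit.QuantumFields.YangMills.Theses.SqueezedSkewness.TorusKL`, by name. -/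
theorem TorusKL_of (h1 : __Registered.stub_torusMixtureData)
    (h2 : __Registered.stub_mixedParseval) :
    TorusKL := by
  intro G _ _ _ _ r St Cfg cc posE P A w E Cov refl B Qrp amp β L T s hβ hL hT hs
  obtain ⟨p, W₀, P', U, ψ, hp, hW₀, hprops, hsum⟩ := h1 G r β L T s hβ hL hT hs
  obtain ⟨W, μ, q, hW, hμ, hall⟩ :=
    h2 L T s hL hT hs (fun f => Qrp β (2 * L + 1) T s f) p W₀ P' U ψ hp hW₀ hprops hsum
  exact ⟨W, μ, q, hW, hμ, fun H f h0 h1' h2' => hall H f h0 h1' h2'⟩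


/-- **`TorusKL` modulo the ONE remaining stub `stub_torusMixtureData`.** -/
theorem torusKL_of_torusMixtureData (h1 : __Registered.stub_torusMixtureData) : TorusKL :=
  TorusKL_of h1 stub_mixedParseval

end Summit.QuantumFields.YangMills.Theorems.SqueezedSkewnessTorusKLStub
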